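import Summits.MatrixMultiplication.MatrixMultiplication.Theses.TetrahedronCarving
import HarnessLib

/-!
# TetraFlatIrreversibilityWindow — where the attacked leaf `TetraFlat` sits against the
IRREVERSIBILITY barrier in the 4-party category (decomp-mm lens 6 «barrier-complement carving»,
generation 16; NODE KERNEL DRAFT, not a route item)

THE BARRIER (CVZ21 schema, transposed to 4-tensors). Write `ω(t,s)` for the relative exponent
(Christandl–Vrana–Zuiddam 2021, Def. 2) between 4-tensors under restriction/degeneration of Kronecker
powers, `⟨2⟩ = ⟨2⟩₄` the 4-party unit tensor, `i(t) := ω(⟨2⟩,t)·ω(t,⟨2⟩) = log R̃(t)/log Q̃(t) ≥ 1` the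
irreversibility. Vrana–Christandl 2017, Thm. 1 (arXiv:1603.03964, p. 3; p. 6 for `K_k^l`): the asymptotic
GHZ-extraction rate of the graph state of `K₄` is `λ(K₄) = 3`, i.e. `ω(T(K₄)_2, ⟨2⟩) = 1/3`
(`Q̃₄(T(K₄)_n) = n^{3+o(1)}`; the vertex flattening gives `≤ n³`). Exactly as in CVZ21 Thm. 9 (two lines:
triangle inequality and this rate), for EVERY 4-tensor `t`:
  `ω(⟨2⟩,t)·ω(t,T(K₄)_2) ≥ ω(⟨2⟩,t)·ω(t,⟨2⟩)/ω(T(K₄)_2,⟨2⟩) = 3·i(t)`,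
and every upper bound on `ω(T(K₄)) = log₂ R̃(T(K₄)_2)` obtained THROUGH `t` (a reduction
`T(K₄)_2^{⊗a} ≤ t^{⊗b}` plus a rank bound for `t`) is `≥ ω(⟨2⟩,t)·ω(t,T(K₄)_2) ≥ 3·i(t)`.
So `TetraFlat` (`ω(T(K₄)) ≤ 4`) is certifiable through `t` only if `i(t) ≤ 4/3` — a WINDOW, where
`ω = 2` through a 3-party vehicle needs the reversible `i = 1` (CVZ21).

THE VEHICLES IN PRINT. CVZ19 (arXiv:1609.07476) Thm. 1.2.2 / Cor. 1.2.6 (`ω(T(K₄)) ≤ 4.63766`) goes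
through the small 4-party Coppersmith–Winograd tensor `cw_q^4 = Σ_{e ∈ E(K₄)} Σ_{i ≤ q} (b_i b_i)_e ⊗
(b_0 b_0)_{rest} ∈ (ℂ^{q+1})^{⊗4}` (Def. 2.2.1, p. 13), BCKLOSW26 (arXiv:2602.11975) Thm. 48
(`ω(T(K₄)) < 4.633908`) through the big one `CW_q^4 ∈ (ℂ^{q+2})^{⊗4}` (Def. 49, Lemma 50, p. 51–52).
  * `R̃(cw_q^4) = R̃(CW_q^4) = q + 2` EXACTLY: border rank `≤ q+2` (CVZ19 Lemma 2.2.2; BCKLOSW26 Lemma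
    50) and the `{1,2}|{3,4}` flattening has rank `q + 2` (rows `(0,0) ↦ Σ_i e_{(i,i)}`, `(i,i) ↦ e_{(0,0)}`,
    `(i,0),(0,i) ↦ e_{(i,0)} + e_{(0,i)}`; checked exactly for `q ≤ 4`). (In three parties
    `R̃(cw_q) ∈ {q+1, q+2}` is open; in four it is not.)
  * `Q̃(cw_q^4) = 2√q` EXACTLY. Upper: Strassen's upper support functional with `θ = (¼,¼,¼,¼)` in the
    standard basis (as CVZ21 p. 9 does for `cw_q`): `max_P ¼ Σ_u H(P_u) = 1 + ½ log₂ q` at the symmetric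
    `P`. Lower (derived here): CVZ19's own degeneration `(cw_q^4)^{⊗s} ⊵ ⊕_{2^{s−o(s)}} T_f(K₄)`,
    `Π_e f(e) = q^s` (proof of Thm. 1.2.2, p. 13, with Cor. 3.5.4's uniform `P`, p. 21); keep one joint
    type (`≤ (s+1)^6` types); Kronecker-multiply the 24 images of this degeneration under `S₄ = Aut(K₄)`
    (`cw_q^4` is `S₄`-invariant), which makes the edge weights uniform, `q^{4s}` each; then
    `Q̃(cw_q^4)^{24s} ≥ 2^{24s−o(s)} · Q̃(T(K₄)_{q^{4s}}) ≥ 2^{24s−o(s)} q^{12s}/8` by the rate 3. For the big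
    tensor `2√q ≤ Q̃(CW_q^4) ≤ B(q)` (`B` = the same functional, numerically `3.079, 3.623, 4.111, 4.555,
    4.963, 5.343, 5.700, 6.036` for `q = 2…9`).
  * Hence `i(cw_q^4) = log₂(q+2) / log₂(2√q)` and the FLOOR `b(q) := 3·i(cw_q^4) = 6·log(q+2)/log(4q)`:
    `q = 2: 4.000 · 3: 3.886 · 4: 3.877 (min) · 5: 3.897 · 6: 3.926 · 7: 3.956 · 8: 3.986 · 9: 4.015 ·
    10: 4.042 · → 6`; for `CW_q^4` the floor lies in `[3·log(q+2)/log B(q), b(q)]`, still `< 4` for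
    `q ≤ 8` and `> 4` for `q ≥ 9`. The achieved values are `6·log_q((q+2)/2)` (`4.6377` at `q = 7`) resp.
    `4.633908`.

PLACEMENT (the kernel facts below certify the arithmetic; the three bullet facts are the cited /
derived inputs): **`TetraFlat` lies INSIDE the irreversibility window of the very vehicles in use —
`b(q) < 4 ≤ ω(T(K₄))` for `3 ≤ q ≤ 8` (`irrFloorK4_lt_four`, `irrFloorK4_lt_omegaTetra`): the barrier's
whole bite sits strictly below the flattening bound, so within the class «degenerations of powers of
`cw_q^4` / `CW_q^4`, `3 ≤ q ≤ 8`» NO irreversibility obstruction to certifying `ω(T(K₄)) = 4` exists;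
outside it (`q = 2`: `b = 4` exactly; `q ≥ 9`: `b > 4`, `four_le_irrFloorK4_of_nine_le`) it does.**
What a certificate of `TetraFlat` through `cw_7^4` must do is use `≥ 4/4.6377·… ≈ 98.9 %` of the
vehicle's capacity `3·i` instead of today's `85.3 %` (`q = 4`: `≥ 96.9 %`); for `⟨n,n,n⟩` and `ω = 2`
the corresponding demand exceeds `100 %` for every irreversible vehicle (CVZ21) — the quantitative
form of «the attacked piece lives in the barrier's complement». `K₄` is the smallest clique for which
this window is non-empty (`(k−1)·i < ` flattening bound has room iff `k ≥ 4`).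

Kernel content: `irrFloorK4`, the equivalence `b(q) < 4 ↔ (q+2)^6 < (4q)^4` (`q ≥ 1`), the window
table `3 ≤ q ≤ 8`, the closed range `q = 2 ∨ q ≥ 9`, and `b(q) < ω(T(K₄))` over every field for
`3 ≤ q ≤ 8` (tree `four_le_omegaTetra`). No `sorry`, no axiom, no instance, no notation; one plain
real-valued definition. Sources: [corpus:paper-arxiv-1603.03964 p.3, p.6] · [corpus:paper-arxiv-1609.07476
p.9, p.13, p.21] · [corpus:paper-arxiv-2602.11975 p.51–52, p.59] · [corpus:paper-arxiv-1812.06952 p.5–7,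
p.9–10] · tree `Literature.Barriers.MatrixMultiplication.IrreversibilityBarrier` (3-tensor version,
`CVZ2021_thm9`).
-/

noncomputable section

set_option linter.dupNamespace false

open Summit.MatrixMultiplication.MatrixMultiplication.Theorems.TetrahedronTensor

namespace Summit.MatrixMultiplication.MatrixMultiplication.Theorems.TetraFlatIrreversibilityWindow

/-- The irreversibility floor of the small 4-party Coppersmith–Winograd tensor `cw_q^4` for bounds on
`ω(T(K₄))`: `b(q) = 3·i(cw_q^4) = 3·log₂(q+2)/log₂(2√q) = 6·log(q+2)/log(4q)`.
[cite: ChristandlVranaZuiddam2021, Thm. 9] -/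
def irrFloorK4 (q : ℕ) : ℝ := 6 * Real.log ((q : ℝ) + 2) / Real.log (4 * (q : ℝ))

/-- `log(4q) > 0` for `q ≥ 1`. [folklore] -/
theorem log_four_mul_pos {q : ℕ} (hq : 1 ≤ q) : 0 < Real.log (4 * (q : ℝ)) := by
  apply Real.log_pos
  have : (1 : ℝ) ≤ q := by exact_mod_cast hq
  linarith

/-- **The window criterion in integers: `b(q) < 4 ↔ (q+2)^6 < (4q)^4`** (`q ≥ 1`). [folklore] -/
theorem irrFloorK4_lt_four_iff {q : ℕ} (hq : 1 ≤ q) :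
    irrFloorK4 q < 4 ↔ (q + 2) ^ 6 < (4 * q) ^ 4 := by
  have hlog := log_four_mul_pos hq
  have hq' : (0 : ℝ) < (q : ℝ) + 2 := by positivity
  have h4q : (0 : ℝ) < 4 * (q : ℝ) := by
    have : (1 : ℝ) ≤ q := by exact_mod_cast hq
    linarith
  unfold irrFloorK4
  rw [div_lt_iff₀ hlog]
  have e1 : 6 * Real.log ((q : ℝ) + 2) = Real.log (((q : ℝ) + 2) ^ 6) := by
    rw [Real.log_pow]; norm_num
  have e2 : 4 * Real.log (4 * (q : ℝ)) = Real.log ((4 * (q : ℝ)) ^ 4) := by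
    rw [Real.log_pow]; norm_num
  rw [e1, e2, Real.log_lt_log_iff (by positivity) (by positivity)]
  constructor
  · intro h
    exact_mod_cast h
  · intro h
    exact_mod_cast h

/-- The complementary criterion: `4 ≤ b(q) ↔ (4q)^4 ≤ (q+2)^6` (`q ≥ 1`). [folklore] -/
theorem four_le_irrFloorK4_iff {q : ℕ} (hq : 1 ≤ q) :
    4 ≤ irrFloorK4 q ↔ (4 * q) ^ 4 ≤ (q + 2) ^ 6 := by
  rw [← not_lt, irrFloorK4_lt_four_iff hq, not_lt]

/-- **THE WINDOW TABLE: `b(q) < 4` for `q = 3, 4, 5, 6, 7, 8`** (`5⁶ < 12⁴`, `6⁶ < 16⁴`, `7⁶ < 20⁴`,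
`8⁶ < 24⁴`, `9⁶ < 28⁴`, `10⁶ < 32⁴`). [folklore] -/
theorem irrFloorK4_lt_four {q : ℕ} (h3 : 3 ≤ q) (h8 : q ≤ 8) : irrFloorK4 q < 4 := by
  rw [irrFloorK4_lt_four_iff (by omega)]
  interval_cases q <;> norm_num

/-- The boundary case `q = 2`: `4⁶ = 8⁴`, so `b(2) = 4` exactly is NOT below `4`. [folklore] -/
theorem four_le_irrFloorK4_two : 4 ≤ irrFloorK4 2 := by
  rw [four_le_irrFloorK4_iff (by norm_num)]
  norm_num

/-- **The closed range: `4 ≤ b(q)` for every `q ≥ 9`** (`(4q)^4 ≤ (q+2)^6`: `9 ≤ q ≤ 13` by evaluation,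
`q ≥ 14` from `(q+2)^2 ≥ 256`). [folklore] -/
theorem four_le_irrFloorK4_of_nine_le {q : ℕ} (h9 : 9 ≤ q) : 4 ≤ irrFloorK4 q := by
  rw [four_le_irrFloorK4_iff (by omega)]
  by_cases h14 : 14 ≤ q
  · have hsq : 256 ≤ (q + 2) ^ 2 := by nlinarith
    have hq4 : q ^ 4 ≤ (q + 2) ^ 4 := Nat.pow_le_pow_left (by omega) 4
    calc (4 * q) ^ 4 = 256 * q ^ 4 := by ring
      _ ≤ (q + 2) ^ 2 * (q + 2) ^ 4 := Nat.mul_le_mul hsq hq4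
      _ = (q + 2) ^ 6 := by ring
  · interval_cases q <;> norm_num

/-- Summary of the two ranges: the window is exactly `3 ≤ q ≤ 8` among `q ≥ 2`. [folklore] -/
theorem irrFloorK4_lt_four_iff_window {q : ℕ} (hq : 2 ≤ q) :
    irrFloorK4 q < 4 ↔ (3 ≤ q ∧ q ≤ 8) := by
  constructor
  · intro h
    by_contra hc
    have : q = 2 ∨ 9 ≤ q := by omega
    rcases this with rfl | h9
    · exact absurd h (not_lt.2 four_le_irrFloorK4_two)
    · exact absurd h (not_lt.2 (four_le_irrFloorK4_of_nine_le h9))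
  · rintro ⟨h3, h8⟩
    exact irrFloorK4_lt_four h3 h8

/-- **PLACEMENT: inside the window the barrier's bite lies strictly below every admissible value of
`ω(T(K₄))`** — `b(q) < 4 ≤ ω(T(K₄))` over every field, `3 ≤ q ≤ 8` (tree `four_le_omegaTetra`): no
irreversibility obstruction to certifying `TetraFlat` through `cw_q^4`. [folklore] -/
theorem irrFloorK4_lt_omegaTetra (F : Type*) [Field F] {q : ℕ} (h3 : 3 ≤ q) (h8 : q ≤ 8) :
    irrFloorK4 q < omegaTetra F :=
  lt_of_lt_of_le (irrFloorK4_lt_four h3 h8) (four_le_omegaTetra F)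

/-- By name: inside the window the floor is below the value `TetraFlat` asserts (`ω(T(K₄)) ≤ 4` is
compatible with `b(q) ≤ ω(T(K₄))`), while for `q ≥ 9` any bound through `cw_q^4` is `≥ b(q) ≥ 4`, so
could at best MEET `TetraFlat`'s value, never certify a smaller one. [folklore] -/
theorem window_summary :
    (∀ q : ℕ, 3 ≤ q → q ≤ 8 → irrFloorK4 q < 4) ∧ (∀ q : ℕ, 9 ≤ q → 4 ≤ irrFloorK4 q) ∧
      4 ≤ irrFloorK4 2 :=
  ⟨fun _ h3 h8 => irrFloorK4_lt_four h3 h8, fun _ h9 => four_le_irrFloorK4_of_nine_le h9,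
    four_le_irrFloorK4_two⟩

end Summit.MatrixMultiplication.MatrixMultiplication.Theorems.TetraFlatIrreversibilityWindow

end
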